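import Summits.ResolutionOfSingularities.ResolutionOfSingularities.Theorems.EquisingularLiftEquisingularLiftNatHypersurfaceLinearCentreBlowup
import Summits.ResolutionOfSingularities.ResolutionOfSingularities.Theorems.EquisingularLiftEquisingularLiftNatLinearCentrePoints
import Summits.ResolutionOfSingularities.ResolutionOfSingularities.Theorems.EquisingularLiftEquisingularLiftNatHorizontalForced
import Literature.AlgebraicGeometry.Resolution.BlowupDisjointCentreSplitting
import Literature.AlgebraicGeometry.Motives.SegreEmbedding
import Mathlib.AlgebraicGeometry.Morphisms.UniversallyOpen
import HarnessLib

/-!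
# [OURS · L1 W4.5(b)] THE MULTI-POINT RUNG FOR EL♮, ANY DIMENSION: one horizontal E1 step along the PRODUCT of finitely many coordinate
# `O`-points (crux `Theses.EquisingularLift.EquisingularLiftNat`, stmt-ResolutionOfSingularities-20038)

NOT a statement of any manuscript; OURS kernel plumbing (cell `res-hironaka`, chain w45b; seat res-D-pv-013, own initiative, counted 0). AI-written,
weaker than expert review. No definition, no `sorry`, standard axioms.

The one-point rung `elNatAt_of_linearCentreKill` (p535275, `r = 0`) blows up ONE coordinate `O`-point of `ℙᴺ_O`. For a hypersurface with SEVERAL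
isolated singular points at coordinate vertices `P_c`, `c ∈ S`, the centre is the PRODUCT `Π_{c ∈ S} Λ_c^O` of the point ideal sheaves
`Λ_c^O = ker Proj(f_O^{(c)})` (kill maps killing every variable but `x_c`). This file checks that this product is an admissible E1 centre and
packages the step:

* `MultiCentre.comap_list_prod` — pull-back of a product of ideal sheaves is the product of the pull-backs (tree `comap_mul`);
* `MultiCentre.exists_horizontal_generization_of_flat` — a closed subscheme `V(I)` FLAT over a discrete valuation ring is topologically horizontal
  (every point of `supp I` generises inside `supp I` off the special fibre: flat morphisms are generalizing);
* `MultiCentre.flat_subschemeι_prod` — hence a product of ideal sheaves with pairwise disjoint supports, regular flat subschemes, over a DVR, has a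
  flat subscheme (`flat_subschemeι_comp_of_horizontal`, …NatHorizontalForced);
* `CoordPoints.disjoint_support_ker` — two distinct coordinate points of `ℙᴺ_R` have disjoint supports (any ring `R`);
* `CoordPoints.isRegular_subscheme_prod`, `flat_subschemeι_prod`, `comap_prod_eq` — the product centre over `O` is regular, `O`-flat, with special
  fibre the product of the `k`-points;
* **`elNatAt_of_coordPointsKill`** — THE MULTI-POINT RUNG: `H ⊆ ℙᴺ_K` integral, `S` a duplicate-free list of coordinates, `Λ = Π_{c∈S} Λ_c^K`; if
  `supp Λ ⊆ ι(H)`, `ι(H) ⊄ supp Λ` and every blow-up of `H` along `Λ·𝒪_H` is regular, then `ELNatAt p K N H ι` (`elNatAt_of_oneStep₀`, p505461, with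
  `O = 𝕎(K)` and the centre `Π_{c∈S} Λ_c^O`).

References: The Stacks Project 080A, 01U2 (generalizations lift along flat morphisms); Hartshorne II Ex. 3.12 — through the cited tree files.
-/

set_option linter.dupNamespace false -- mandated namespace `Summit.<Summit>.<Problem>` of this single-conjunct summit

noncomputable section

open CategoryTheory CategoryTheory.Limits AlgebraicGeometry TopologicalSpace
open MvPolynomial HomogeneousLocalization
open Literature.AlgebraicGeometry.Resolution
open Literature.AlgebraicGeometry.Motives
open AlgebraicGeometry.Scheme.IdealSheafData
open Summit.ResolutionOfSingularities.ResolutionOfSingularities.Cruxes.EquisingularLift.StrataSplit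

universe u

namespace Summit.ResolutionOfSingularities.ResolutionOfSingularities.Cruxes.EquisingularLiftNat.Sections

attribute [local instance] MvPolynomial.gradedAlgebra ProjBaseChange.algebraBase

/-! ## Products of ideal sheaves: pull-back, horizontality, flatness -/

namespace MultiCentre

/-- **Pull-back of a product of ideal sheaves is the product of the pull-backs** (tree `comap_mul`, Mathlib `comap_top`). [folklore] -/
theorem comap_list_prod {X Y : Scheme.{u}} (g : X ⟶ Y) (L : List Y.IdealSheafData) :
    L.prod.comap g = (L.map fun I => I.comap g).prod := by
  induction L with
  | nil =>
    rw [List.map_nil, List.prod_nil, List.prod_nil, Scheme.IdealSheafData.one_eq_top, Scheme.IdealSheafData.comap_top,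
      Scheme.IdealSheafData.one_eq_top]
  | cons I L ih => rw [List.map_cons, List.prod_cons, List.prod_cons, comap_mul, ih]

/-- **A closed subscheme flat over a discrete valuation ring is topologically horizontal**: every point `x₀ ∈ supp I` has a generisation inside
`supp I` off the special fibre (if `x₀` itself lies over the closed point: generalizations lift along the flat `V(I) → Spec O`, Stacks 01U2, and the
generic point of `Spec O` generises the closed point). [cite: StacksProject, Tag 01U2] -/
theorem exists_horizontal_generization_of_flat {O : Type} [CommRing O] [IsDomain O] [IsDiscreteValuationRing O]
    {X : Scheme.{0}} (f : X ⟶ Spec (.of O)) (I : X.IdealSheafData) (hflat : Flat (I.subschemeι ≫ f)) :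
    ∀ x₀ ∈ (I.support : Set X), ∃ c ∈ (I.support : Set X), c ∉ f ⁻¹' {IsLocalRing.closedPoint O} ∧ c ⤳ x₀ := by
  intro x₀ hx₀
  by_cases hs : f x₀ = IsLocalRing.closedPoint O
  swap
  · exact ⟨x₀, hx₀, hs, specializes_rfl⟩
  rw [← Scheme.IdealSheafData.range_subschemeι] at hx₀
  obtain ⟨z₀, rfl⟩ := hx₀
  -- the generic point of `Spec O` generises `f x₀`; lift along the flat `V(I) → Spec O`
  let ξ : Spec (.of O) := (⟨⊥, Ideal.isPrime_bot⟩ : PrimeSpectrum O)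
  have hξ : ξ ⤳ (I.subschemeι ≫ f) z₀ :=
    (PrimeSpectrum.le_iff_specializes ξ ((I.subschemeι ≫ f) z₀)).mp (by change (⊥ : Ideal O) ≤ _; exact bot_le)
  haveI := hflat
  obtain ⟨z, hzz₀, hz⟩ := Flat.generalizingMap (I.subschemeι ≫ f) hξ
  refine ⟨I.subschemeι z, ?_, ?_, hzz₀.map I.subschemeι.continuous⟩
  · rw [← Scheme.IdealSheafData.range_subschemeι]
    exact ⟨z, rfl⟩
  · intro hc
    have h1 : f (I.subschemeι z) = ξ := by
      rw [← Scheme.Hom.comp_apply]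
      exact hz
    have hc' : f (I.subschemeι z) = IsLocalRing.closedPoint O := hc
    rw [h1] at hc'
    have h2 := congrArg PrimeSpectrum.asIdeal hc'
    exact IsDiscreteValuationRing.not_a_field O h2.symm

/-- **A product of ideal sheaves over a DVR with pairwise disjoint supports and regular, flat subschemes has a flat subscheme**: its support is the
union of the supports, each topologically horizontal (`exists_horizontal_generization_of_flat`), and a regular topologically horizontal centre is
flat (`flat_subschemeι_comp_of_horizontal`). [cite: StacksProject, Tag 01U2] -/
theorem flat_subschemeι_prod {O : Type} [CommRing O] [IsDomain O] [IsDiscreteValuationRing O]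
    {X : Scheme.{0}} [IsLocallyNoetherian X] (f : X ⟶ Spec (.of O)) (L : List X.IdealSheafData)
    (hreg : ∀ I ∈ L, Scheme.IsRegular I.subscheme)
    (hflat : ∀ I ∈ L, Flat (I.subschemeι ≫ f))
    (hL : L.Pairwise fun I J : X.IdealSheafData => Disjoint (I.support : Set X) J.support) :
    Flat (L.prod.subschemeι ≫ f) := by
  refine flat_subschemeι_comp_of_horizontal f L.prod (isRegular_subscheme_prod_of_pairwise_disjoint L hreg hL) ?_
  intro x₀ hx₀
  rw [IdealSheafData.coe_support_prod, Set.mem_iUnion₂] at hx₀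
  obtain ⟨I, hI, hx₀I⟩ := hx₀
  obtain ⟨c, hc, hcs, hcx⟩ := exists_horizontal_generization_of_flat f I (hflat I hI) x₀ hx₀I
  refine ⟨c, ?_, hcs, hcx⟩
  rw [IdealSheafData.coe_support_prod, Set.mem_iUnion₂]
  exact ⟨I, hI, hc⟩

end MultiCentre

/-! ## Coordinate points of `ℙᴺ_R`: disjoint supports, and the product centre -/

namespace CoordPoints

section AnyRing

variable {R : Type} [CommRing R] {N : ℕ}
  (f : Fin (N + 1) → (homogeneousSubmodule (Fin (N + 1)) R →+*ᵍ homogeneousSubmodule (Fin (0 + 1)) R))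
  (hf' : ∀ c, HomogeneousIdeal.irrelevant (homogeneousSubmodule (Fin (0 + 1)) R) ≤
    (HomogeneousIdeal.irrelevant (homogeneousSubmodule (Fin (N + 1)) R)).map (f c))
  (hfC : ∀ c (a : R), f c (C a) = C a) (hfe : ∀ c (j : Fin 1), f c (X c) = X j)
  (hf0 : ∀ c (i : Fin (N + 1)), i ≠ c → f c (X i) = 0)

omit hf' in
include hfe in
/-- The kill map of the point `P_c` in the `e`-convention of the linear-centre files (`e : Fin 1 → Fin (N+1)`, `e _ = c`). [folklore] -/
theorem hfe' (c : Fin (N + 1)) : ∀ j : Fin 1, f c (X ((fun _ : Fin 1 => c) j)) = X j := fun j => hfe c j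

omit hf' in
include hf0 in
/-- The kill map of the point `P_c` kills every other variable (`e`-convention). [folklore] -/
theorem hf0' (c : Fin (N + 1)) : ∀ i : Fin (N + 1), i ∉ Set.range (fun _ : Fin 1 => c) → f c (X i) = 0 :=
  fun i hi => hf0 c i (fun h => hi ⟨0, h.symm⟩)

include hfC hfe hf0 in
/-- **On `supp Λ_c` every variable but `x_c` vanishes** (`Λ_c = ker Proj(f^{(c)})`). [cite: Hartshorne1977, II Ex. 3.12 (a)] -/
theorem X_mem_of_mem_support {c : Fin (N + 1)} {y : Proj (homogeneousSubmodule (Fin (N + 1)) R)}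
    (hy : y ∈ ((Proj.map (f c) (hf' c)).ker.support : Set (Proj (homogeneousSubmodule (Fin (N + 1)) R)))) {i : Fin (N + 1)} (hi : i ≠ c) :
    (X i : MvPolynomial (Fin (N + 1)) R) ∈ y.asHomogeneousIdeal :=
  LinearCentre.X_mem_asHomogeneousIdeal_of_mem_support (fun _ : Fin 1 => c) (f c) (hf' c) (hfC c) (hfe' f hfe c) (hf0' f hf0 c) hy
    (fun ⟨_, hj⟩ => hi hj.symm)

include hfC hfe hf0 in
/-- **Two distinct coordinate points have disjoint supports**: on the intersection every variable would vanish, i.e. the irrelevant ideal would lie in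
the point's homogeneous prime. [cite: Hartshorne1977, II Ex. 3.12 (a)] -/
theorem disjoint_support_ker {c c' : Fin (N + 1)} (hcc' : c ≠ c') :
    Disjoint ((Proj.map (f c) (hf' c)).ker.support : Set (Proj (homogeneousSubmodule (Fin (N + 1)) R)))
      ((Proj.map (f c') (hf' c')).ker.support : Set (Proj (homogeneousSubmodule (Fin (N + 1)) R))) := by
  rw [Set.disjoint_iff]
  rintro y ⟨hy, hy'⟩
  apply y.not_irrelevant_le
  intro q hq
  have hall : ∀ i : Fin (N + 1), (X i : MvPolynomial (Fin (N + 1)) R) ∈ y.asHomogeneousIdeal := fun i => by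
    by_cases hic : i = c
    · subst hic
      exact X_mem_of_mem_support f hf' hfC hfe hf0 hy' hcc'
    · exact X_mem_of_mem_support f hf' hfC hfe hf0 hy hic
  have hle : Ideal.span (Set.range (X : Fin (N + 1) → MvPolynomial (Fin (N + 1)) R)) ≤ y.asHomogeneousIdeal.toIdeal :=
    Ideal.span_le.mpr (Set.range_subset_iff.mpr hall)
  exact hle (Segre.irrelevant_le_span_X (Fin (N + 1)) R hq)

include hfC hfe hf0 in
/-- The supports of the coordinate points listed by a duplicate-free `S` are pairwise disjoint. [folklore] -/
theorem pairwise_disjoint_support (S : List (Fin (N + 1))) (hS : S.Nodup) :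
    (S.map fun c => (Proj.map (f c) (hf' c)).ker).Pairwise fun I J : (Proj (homogeneousSubmodule (Fin (N + 1)) R)).IdealSheafData =>
      Disjoint (I.support : Set (Proj (homogeneousSubmodule (Fin (N + 1)) R))) J.support := by
  rw [List.pairwise_map]
  exact hS.pairwise_of_forall_ne (fun c _ c' _ hcc' => disjoint_support_ker f hf' hfC hfe hf0 hcc')

/-- **The support of the product of the points of `S` is the union of the points' supports.** [folklore] -/
theorem mem_support_prod_iff (S : List (Fin (N + 1))) (y : Proj (homogeneousSubmodule (Fin (N + 1)) R)) :
    y ∈ ((S.map fun c => (Proj.map (f c) (hf' c)).ker).prod.support : Set (Proj (homogeneousSubmodule (Fin (N + 1)) R))) ↔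
      ∃ c ∈ S, y ∈ ((Proj.map (f c) (hf' c)).ker.support : Set (Proj (homogeneousSubmodule (Fin (N + 1)) R))) := by
  rw [IdealSheafData.coe_support_prod, Set.mem_iUnion₂]
  constructor
  · rintro ⟨I, hI, hyI⟩
    obtain ⟨c, hc, rfl⟩ := List.mem_map.mp hI
    exact ⟨c, hc, hyI⟩
  · rintro ⟨c, hc, hyc⟩
    exact ⟨_, List.mem_map.mpr ⟨c, hc, rfl⟩, hyc⟩

end AnyRing

section OverO

variable {O : Type} [CommRing O] [IsDomain O] [IsDiscreteValuationRing O] {N : ℕ}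
  (fO : Fin (N + 1) → (homogeneousSubmodule (Fin (N + 1)) O →+*ᵍ homogeneousSubmodule (Fin (0 + 1)) O))
  (hfO' : ∀ c, HomogeneousIdeal.irrelevant (homogeneousSubmodule (Fin (0 + 1)) O) ≤
    (HomogeneousIdeal.irrelevant (homogeneousSubmodule (Fin (N + 1)) O)).map (fO c))
  (hfOC : ∀ c (a : O), fO c (C a) = C a) (hfOe : ∀ c (j : Fin 1), fO c (X c) = X j)
  (hfO0 : ∀ c (i : Fin (N + 1)), i ≠ c → fO c (X i) = 0)

/-- `ℙᴺ_O` is locally Noetherian (smooth over the Noetherian `O`). [folklore] -/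
theorem isLocallyNoetherian_proj : IsLocallyNoetherian (Proj (homogeneousSubmodule (Fin (N + 1)) O)) := by
  haveI := (stub_projectiveAmbientSmoothProper O N).1
  exact LocallyOfFiniteType.isLocallyNoetherian (Proj.toSpecZero (homogeneousSubmodule (Fin (N + 1)) O) ≫
    Spec.map (CommRingCat.ofHom (algebraMap O ((homogeneousSubmodule (Fin (N + 1)) O) 0))))

include hfOC hfOe hfO0 in
/-- **The product of the coordinate `O`-points of `S` is a regular centre** (`isRegular_subscheme_prod_of_pairwise_disjoint` with
`LinearCentre.isRegular_kerSubscheme`). [cite: StacksProject, Tag 02IS] -/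
theorem isRegular_subscheme_prod (S : List (Fin (N + 1))) (hS : S.Nodup) :
    Scheme.IsRegular (S.map fun c => (Proj.map (fO c) (hfO' c)).ker).prod.subscheme := by
  haveI := isLocallyNoetherian_proj (O := O) (N := N)
  refine isRegular_subscheme_prod_of_pairwise_disjoint _ (fun I hI => ?_) (pairwise_disjoint_support fO hfO' hfOC hfOe hfO0 S hS)
  obtain ⟨c, -, rfl⟩ := List.mem_map.mp hI
  exact LinearCentre.isRegular_kerSubscheme (fun _ : Fin 1 => c) (fO c) (hfO' c) (hfOC c) (hfe' fO hfOe c)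

include hfOC hfOe hfO0 in
/-- **The product of the coordinate `O`-points of `S` is `O`-flat** (`MultiCentre.flat_subschemeι_prod` with `LinearCentre.flat_kerSubschemeι_comp`).
[cite: StacksProject, Tag 01U2] -/
theorem flat_subschemeι_prod (S : List (Fin (N + 1))) (hS : S.Nodup) :
    Flat ((S.map fun c => (Proj.map (fO c) (hfO' c)).ker).prod.subschemeι ≫
      (Proj.toSpecZero (homogeneousSubmodule (Fin (N + 1)) O) ≫
        Spec.map (CommRingCat.ofHom (algebraMap O ((homogeneousSubmodule (Fin (N + 1)) O) 0))))) := by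
  haveI := isLocallyNoetherian_proj (O := O) (N := N)
  refine MultiCentre.flat_subschemeι_prod _ _ (fun I hI => ?_) (fun I hI => ?_) (pairwise_disjoint_support fO hfO' hfOC hfOe hfO0 S hS)
  · obtain ⟨c, -, rfl⟩ := List.mem_map.mp hI
    exact LinearCentre.isRegular_kerSubscheme (fun _ : Fin 1 => c) (fO c) (hfO' c) (hfOC c) (hfe' fO hfOe c)
  · obtain ⟨c, -, rfl⟩ := List.mem_map.mp hI
    exact LinearCentre.flat_kerSubschemeι_comp (fun _ : Fin 1 => c) (fO c) (hfO' c) (hfOC c) (hfe' fO hfOe c)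

variable {k : Type} [CommRing k] (π : O →+* k) (hπ : Function.Surjective π)
  (φ : (homogeneousSubmodule (Fin (N + 1)) O) →+*ᵍ (homogeneousSubmodule (Fin (N + 1)) k))
  (hφ : ∀ q, φ q = MvPolynomial.map π q)
  (hφ' : HomogeneousIdeal.irrelevant (homogeneousSubmodule (Fin (N + 1)) k) ≤
    (HomogeneousIdeal.irrelevant (homogeneousSubmodule (Fin (N + 1)) O)).map φ)
  (fk : Fin (N + 1) → (homogeneousSubmodule (Fin (N + 1)) k →+*ᵍ homogeneousSubmodule (Fin (0 + 1)) k))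
  (hfk' : ∀ c, HomogeneousIdeal.irrelevant (homogeneousSubmodule (Fin (0 + 1)) k) ≤
    (HomogeneousIdeal.irrelevant (homogeneousSubmodule (Fin (N + 1)) k)).map (fk c))
  (hfkC : ∀ c (a : k), fk c (C a) = C a) (hfke : ∀ c (j : Fin 1), fk c (X c) = X j)
  (hfk0 : ∀ c (i : Fin (N + 1)), i ≠ c → fk c (X i) = 0)

omit [IsDomain O] [IsDiscreteValuationRing O] in
include hπ hφ hfOC hfOe hfO0 hfkC hfke hfk0 in
/-- **The special fibre of the product centre is the product of the `k`-points** (`MultiCentre.comap_list_prod` with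
`LinearCentre.ker_projMap_kill_eq_comap`). [folklore] -/
theorem comap_prod_eq (S : List (Fin (N + 1))) :
    (S.map fun c => (Proj.map (fO c) (hfO' c)).ker).prod.comap (Proj.map φ hφ') = (S.map fun c => (Proj.map (fk c) (hfk' c)).ker).prod := by
  rw [MultiCentre.comap_list_prod, List.map_map]
  congr 1
  refine List.map_congr_left fun c _ => ?_
  simp only [Function.comp_apply]
  exact (LinearCentre.ker_projMap_kill_eq_comap π hπ (fun _ : Fin 1 => c) φ hφ hφ' (fO c) (hfO' c) (hfOC c) (hfe' fO hfOe c)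
    (hf0' fO hfO0 c) (fk c) (hfk' c) (hfkC c) (hfe' fk hfke c) (hf0' fk hfk0 c)).symm

end OverO

end CoordPoints

/-! ## The multi-point rung -/

/-- **THE MULTI-POINT RUNG FOR EL♮** (ambient `Fin (N + 1)`, any `N`): `H ⊆ ℙᴺ_K` integral, `S` a duplicate-free list of coordinates, `Λ_c = ker Proj(f_K^{(c)})`
the ideal sheaf of the coordinate point `P_c` and `Λ = Π_{c ∈ S} Λ_c`; if `supp Λ ⊆ ι(H)`, `ι(H) ⊄ supp Λ` and every blow-up of `H` along `Λ·𝒪_H` is regular,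
then `ELNatAt p K N H ι` — ONE horizontal E1 step over `𝕎(K)` with centre `Π_{c∈S} ker Proj(f_O^{(c)})`, which is regular
(`CoordPoints.isRegular_subscheme_prod`), `O`-flat (`CoordPoints.flat_subschemeι_prod`) and has special fibre `Λ` (`CoordPoints.comap_prod_eq`);
packaged by `elNatAt_of_oneStep₀` (p505461). The one-point case is `elNatAt_of_linearCentreKill` (p535275). [OURS · L1 W4.5b] [folklore] -/
theorem elNatAt_of_coordPointsKill (p : ℕ) (hp : p.Prime) (K : Type) [Field K] [CharP K p] [IsAlgClosed K] {N : ℕ}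
    (S : List (Fin (N + 1))) (hS : S.Nodup)
    (H : Scheme.{0}) (ι : H ⟶ (projectiveSpace N K).left) [IsClosedImmersion ι] [IsIntegral H]
    (fk : Fin (N + 1) → (homogeneousSubmodule (Fin (N + 1)) K →+*ᵍ homogeneousSubmodule (Fin (0 + 1)) K))
    (hfk' : ∀ c, HomogeneousIdeal.irrelevant (homogeneousSubmodule (Fin (0 + 1)) K) ≤
      (HomogeneousIdeal.irrelevant (homogeneousSubmodule (Fin (N + 1)) K)).map (fk c))
    (hfkC : ∀ c (a : K), fk c (C a) = C a) (hfke : ∀ c (j : Fin 1), fk c (X c) = X j)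
    (hfk0 : ∀ c (i : Fin (N + 1)), i ≠ c → fk c (X i) = 0)
    (hsupp : (((S.map fun c => (Proj.map (fk c) (hfk' c)).ker).prod).support : Set (Proj (homogeneousSubmodule (Fin (N + 1)) K))) ⊆ Set.range ι)
    (hgen : ¬ (Set.range ι ⊆ (((S.map fun c => (Proj.map (fk c) (hfk' c)).ker).prod).support : Set (Proj (homogeneousSubmodule (Fin (N + 1)) K)))))
    (hdown : ∀ (Z : Scheme.{0}) (ρ : Z ⟶ H), IsBlowup ρ (((S.map fun c => (Proj.map (fk c) (hfk' c)).ker).prod).comap ι) → Scheme.IsRegular Z) :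
    Theorems.EquisingularLift.ELNatAt p K N H ι := by
  classical
  obtain ⟨O, i1, i2, i3, i4, -, -, π, hπ⟩ := stub_wittRing p hp K
  have he : ∀ c : Fin (N + 1), Function.Injective (fun _ : Fin 1 => c) := fun c => Function.injective_of_subsingleton _
  have hexO : ∀ c : Fin (N + 1), ∃ (g : homogeneousSubmodule (Fin (N + 1)) O →+*ᵍ homogeneousSubmodule (Fin (0 + 1)) O)
      (_ : HomogeneousIdeal.irrelevant (homogeneousSubmodule (Fin (0 + 1)) O) ≤
        (HomogeneousIdeal.irrelevant (homogeneousSubmodule (Fin (N + 1)) O)).map g),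
      (∀ a : O, g (C a) = C a) ∧ (∀ j : Fin 1, g (X ((fun _ : Fin 1 => c) j)) = X j) ∧
        (∀ i : Fin (N + 1), i ∉ Set.range (fun _ : Fin 1 => c) → g (X i) = 0) := fun c =>
    LinearCentre.exists_kill (R := O) (fun _ : Fin 1 => c) (he c)
  choose fO hfO' hfOC hfOe hfO0 using hexO
  have hfOe' : ∀ c (j : Fin 1), fO c (X c) = X j := fun c j => hfOe c j
  have hfO0' : ∀ c (i : Fin (N + 1)), i ≠ c → fO c (X i) = 0 := fun c i hi => hfO0 c i (fun ⟨_, hj⟩ => hi hj.symm)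
  refine elNatAt_of_oneStep₀ K N H ι O π hπ (S.map fun c => (Proj.map (fO c) (hfO' c)).ker).prod
    (CoordPoints.isRegular_subscheme_prod fO hfO' hfOC hfOe' hfO0' S hS) (CoordPoints.flat_subschemeι_prod fO hfO' hfOC hfOe' hfO0' S hS)
    (S.map fun c => (Proj.map (fk c) (hfk' c)).ker).prod ?_ hgen hsupp hdown
  intro φ hφ' hφ
  exact CoordPoints.comap_prod_eq fO hfO' hfOC hfOe' hfO0' π hπ φ hφ hφ' fk hfk' hfkC hfke hfk0 S

end Summit.ResolutionOfSingularities.ResolutionOfSingularities.Cruxes.EquisingularLiftNat.Sections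

end
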